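import Summits.QuantumFields.BalabanUV.Beta.FP.TowerFWeightRecDefs
import Summits.QuantumFields.BalabanUV.Beta.FP.TowerDoorGaugeBoundG
import Summits.QuantumFields.BalabanUV.Beta.FP.TowerDoorDefectFamilyLoc

/-!
# `BalabanUV.Beta.FP.TowerFWeightRecLoc` — row D1 ∕ (C1) OWNER «beta-an2», PART 97, ROUTE T (β1), option (3a): **(Lw) — THE TRUE TOP-STEP WEIGHT IS EXPONENTIALLY
# LOCALISED**, i.e. the road's displayed letter `hwloc : ∀ j, ∃ δ C, 0 < δ ∧ 0 ≤ C ∧ ∀ κ l p, |w j κ l p| ≤ C·exp(−δ·|p|₁)` (`FP/TowerFTransportRowW ∕ TowerFAnchorRowW` p753559∕p753568)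
# DISCHARGED at `w := wF Lc Q ℓ sn` (PART 96 `TowerFWeightRecDefs`) under ONE displayed brick bound `hℓb : ∀ μ y f, |ℓ μ y f| ≤ Bℓ` — from an2 `decays_scaleK_AN` (the σ-chart's
# column decays from the source block: lit `abs_colH_le`), PART 83 `exists_abs_lamZG_record_le_exp` (the record gauge function decays from the source block, hence so does its lattice
# gradient `dz`), an1 `compLinKer_eq_zero ∕ abs_compLinKer_le` (the composite linearised averaging kernel has a finite window `winF (Lc^(n+1)) (wid Lc (n+1))` and a uniform bound) and
# the window geometry (inside the window the finest bond is within `4·wid` of `Lc^(n+1)•t`, and `|Lc^(n+1)•(t − Lc•y)|₁ ≥ |t − Lc•y|₁`)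
# (β-function cell `pub-balaban`, BINDER-OWNERS row D1; an2 `gen84/F-JUNCTION-WORDS.md` §1 (Lw); road A-5 l.69169 «+ (Lw) as `hwloc`», AGREED W-11 l.69171; S-1 l.69185)

WHAT ([folklore], 0 `def`): §1 small lattice-norm helpers (`l1_natCast_smul'`, `l1_neg'`, `card_winF_real` (an2 `CompositeVertexKernelLiftContract.card_winF` ℝ-cast), `l1_smul_sub_le_of_mem_winF`, `exp_neg_mul_le_of_le`); §2 `exists_abs_respCol_le` — `|respCol Lc Q s n μ y κ′ u| ≤ C·e^{−δ|u − Lc^(n+2)•y|₁}`;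
§3 `exists_abs_wFRec_le (hB) (hℓb)` — `|wFRec Lc Q ℓ sn n μ y c t| ≤ C·e^{−δ|t − Lc•y|₁}`; §4 **`hwloc_wF (hB) (hℓb) : ∀ n, ∃ δ C, 0 < δ ∧ 0 ≤ C ∧ ∀ κ l p, |wF Lc Q ℓ sn n κ l p| ≤ C·exp(−δ·|p|₁)`**
— the road's `hwloc` text at `w := wF Lc Q ℓ sn`, character for character; §5 the two row tokens' INSTANCES with no hypothesis left (`hℓsh_linKerAt ∕ hℓsh_symLinKerAt` for PART 96's (Tw),
`hwloc_wF_rooted` at `ℓ := linKerAt (toSite (ctrOff 4 Lc)) Lc`, `hwloc_wF_sym` at `ℓ := symLinKerAt (toSite R.r) Lc` — lit `abs_linKerAt_le` ∕ an1 `abs_symLinKerAt_le`, `Bℓ := ell 4 Lc`).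
WHAT THIS IS NOT: not `hWT` (displayed by the END); not the `Summable`∕`AbsMoment₂` letters in `DressedEntryWeightAlgebra`'s shapes (they follow from `hwloc_wF` by the road's own
`KernelStepDressing` lemmas, as for `wStep`); nothing of the END instantiated; nothing of Bałaban's asserted, valued or discharged; 0 estimates beyond [folklore] geometric bookkeeping;
0∕4 row-D1 binders (hW, hR, D1Tel, D1Rep); ROOT M‴ p325680 ∕ P5c ∕ D6 untouched; NOT (C1), NOT (T-ID), NOT D1, NEVER «G-an2-4 closed», NOT BetaPertH, NOT continuum, NOT Clay.

HONEST DEPENDENCY (page 1, mandatory): continuum YM on T⁴ ⇐ BetaPertH ∧ nine spine estimates (0/9 proved); BetaPertH ⇐ (D1) ∧ (D4) ∧ CAP+tail;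
G-an2-4 gates asym, D1 and NE2/3/4.  HONEST FRAMING (cell contract, verbatim): «discharging `BetaPertH` makes Bałaban's UV stability UNCONDITIONAL —
a real constructive-QFT result; it is NOT the continuum limit and NOT the Clay problem.»  ABSOLUTE RULE (cell charter, verbatim): «No internally-minted
statement may enter as a cited fact. Every hypothesis is either kernel-proved in this package or a verbatim quotation of a PUBLISHED theorem with page
reference. The manuscript(s) under audit are NOT citable for their own disputed steps — they are the thing under adjudication; programme-internal
(2001/route/tribunal) claims are never citable.»  Row D1 ∕ (C1) OWNER «beta-an2», b2b-balaban-beta-an2 gen 85, 2026-08-30.  No existing file touched.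
-/

noncomputable section

open Finset
open scoped BigOperators
open Literature.MathematicalPhysics.QuantumFieldTheory
open Literature.MathematicalPhysics.QuantumFieldTheory.Balaban1983to89
open Literature.MathematicalPhysics.QuantumFieldTheory.Balaban1983to89.Beta
open B12Sec2to5 (l1 l1_nonneg)
open ExpKernelCalculus (MKer Decays l1_sub_triangle l1_sub_symm)
open AffineAveraging (Site toSite unitVec dz)
open AveragingContoursRooted (ctrOff ctrOff_mem_box)
open AveragingHessianKernels (Bond ell)
open AveragingHessianKernelsRooted (linKerAt)
open OneStepResolventKernel (Fib)
open HessKerRate (scaleK)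
open OneStepKernelFamily (colH abs_colH_le)
open Summit.QuantumFields.BalabanUV.Beta.CompositeVertexKernelRec (compLinKer winF wid mem_winF_iff compLinKer_eq_zero abs_compLinKer_le)
open Summit.QuantumFields.BalabanUV.Beta.CompositeOneShotJetData (Roots Roots.ctr AN)
open Summit.QuantumFields.BalabanUV.Beta.SymAveragingHessianCounts (symLinKerAt)
open Summit.QuantumFields.BalabanUV.Beta.AxialDressingRooted (one_le_of_neZero)
open Summit.QuantumFields.BalabanUV.Beta.GAN24.FineReadoutCauchyFrame (toSite_mem_range)
open Summit.QuantumFields.BalabanUV.Beta.FP.TorusCompositeObjects (bigRatio bigRatio_eq_pow)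
open Summit.QuantumFields.BalabanUV.Beta.FP.TorusCompositeObjectsG (StepRows)
open Summit.QuantumFields.BalabanUV.Beta.FP.TowerDoorGaugeBound (decays_scaleK_AN)
open Summit.QuantumFields.BalabanUV.Beta.FP.TowerDoorGaugeBoundG (exists_abs_lamZG_record_le_exp)
open Summit.QuantumFields.BalabanUV.Beta.FP.TowerDoorRecordDefsG (lamRecG)
open Summit.QuantumFields.BalabanUV.Beta.FP.TowerFWeightRecDefs

namespace Summit.QuantumFields.BalabanUV.Beta.FP.TowerFWeightRecLoc

/-! ## §1 Three lattice helpers -/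

/-- [folklore] `|m•v|₁ = m·|v|₁` for a natural scalar. -/
theorem l1_natCast_smul' (m : ℕ) (v : Site (3 + 1)) : l1 ((m : ℤ) • v) = (m : ℝ) * l1 v := by
  unfold B12Sec2to5.l1
  rw [Finset.mul_sum]
  refine Finset.sum_congr rfl fun i _ => ?_
  rw [Pi.smul_apply, smul_eq_mul, Int.cast_mul, Int.cast_natCast, abs_mul, abs_of_nonneg (Nat.cast_nonneg m)]

/-- [folklore] `|−v|₁ = |v|₁`. -/
theorem l1_neg' (v : Site (3 + 1)) : l1 (-v) = l1 v := by
  unfold B12Sec2to5.l1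
  exact Finset.sum_congr rfl fun i _ => by rw [Pi.neg_apply, Int.cast_neg, abs_neg]

/-- [folklore] the window `winF N W y` has `(W+1)^{4}` sites, ℝ-cast (an2 `CompositeVertexKernelLiftContract.card_winF`). -/
theorem card_winF_real (N W : ℕ) (y : Site (3 + 1)) : ((winF N W y).card : ℝ) = ((W : ℝ) + 1) ^ (3 + 1) := by
  rw [CompositeVertexKernelLiftContract.card_winF N W y]; push_cast; ring

/-- [folklore] **inside the window**: `u ∈ winF N W t` ⟹ `|N•t − u|₁ ≤ 4·W` (coordinatewise `N t_i ≤ u_i ≤ N t_i + W`). -/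
theorem l1_smul_sub_le_of_mem_winF {N W : ℕ} {t u : Site (3 + 1)} (hu : u ∈ winF N W t) :
    l1 (((N : ℕ) : ℤ) • t - u) ≤ ((3 : ℝ) + 1) * (W : ℝ) := by
  rw [mem_winF_iff] at hu
  unfold B12Sec2to5.l1
  have hi : ∀ i : Fin (3 + 1), |(((((N : ℕ) : ℤ) • t - u) i : ℤ) : ℝ)| ≤ (W : ℝ) := by
    intro i
    obtain ⟨h1, h2⟩ := hu i
    have e : ((((N : ℕ) : ℤ) • t - u) i : ℤ) = (N : ℤ) * t i - u i := by
      simp only [Pi.sub_apply, Pi.smul_apply, smul_eq_mul]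
    rw [e, abs_le]
    have h1' : (N : ℝ) * (t i : ℝ) ≤ (u i : ℝ) := by exact_mod_cast h1
    have h2' : (u i : ℝ) ≤ (N : ℝ) * (t i : ℝ) + (W : ℝ) := by exact_mod_cast h2
    push_cast
    constructor <;> linarith
  calc ∑ i : Fin (3 + 1), |(((((N : ℕ) : ℤ) • t - u) i : ℤ) : ℝ)| ≤ ∑ _i : Fin (3 + 1), (W : ℝ) := Finset.sum_le_sum fun i _ => hi i
    _ = ((3 : ℝ) + 1) * (W : ℝ) := by rw [Finset.sum_const, Finset.card_univ, Fintype.card_fin, nsmul_eq_mul]; push_cast; ring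

/-- [folklore] a slower rate is a weaker decay: `e^{−δ r} ≤ e^{−δ₀ r}` for `δ₀ ≤ δ`, `0 ≤ r`. -/
theorem exp_neg_mul_le_of_le {δ₀ δ r : ℝ} (h : δ₀ ≤ δ) (hr : 0 ≤ r) : Real.exp (-δ * r) ≤ Real.exp (-δ₀ * r) :=
  Real.exp_le_exp.2 (by nlinarith)

/-! ## §2 The response column decays from the source block -/

section RespCol

variable (Lc : ℕ) [NeZero Lc] (Q : StepRows 3 Lc)

/-- [folklore] **`respCol` DECAYS FROM THE SOURCE BLOCK**: `|respCol Lc Q s n μ y κ′ u| ≤ C·e^{−δ·|u − Lc^(n+2)•y|₁}` — the σ-chart's `ℋ`-column by an2 `decays_scaleK_AN` + lit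
`abs_colH_le`, the two values of the record gauge function by PART 83 `exists_abs_lamZG_record_le_exp` (the shifted one at the price `e^{δ}`, `|e_κ′|₁ = 1`), at the common rate
`min δ₁ δ₂`. -/
theorem exists_abs_respCol_le (s : ℝ) (n : ℕ) : ∃ δ C : ℝ, 0 < δ ∧ 0 ≤ C ∧ ∀ (μ : Fin (3 + 1)) (y : Site (3 + 1)) (κ' : Fin (3 + 1)) (u : Site (3 + 1)),
    |respCol Lc Q s n μ y κ' u| ≤ C * Real.exp (-δ * l1 (u - (((Lc ^ (n + 1 + 1) : ℕ) : ℤ)) • y)) := by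
  obtain ⟨δ₁, C₁, hδ₁, hC₁, hA⟩ := decays_scaleK_AN (Roots.ctr Lc)
    (Sum.elim (fun _ : Fin (3 + 1) => (1 : ℝ)) (fun _ : Fin (3 + 1) => s⁻¹)) (n + 1)
  obtain ⟨δ₂, hδ₂, K, hK, hlamb⟩ := exists_abs_lamZG_record_le_exp Q (Roots.ctr Lc) (fun i : ℕ => n + 1 - i) (fun _ : ℕ => ctrOff (3 + 1) Lc)
    (fun _ => toSite_mem_range (ctrOff_mem_box (d := 3 + 1) (Nat.one_le_iff_ne_zero.mpr (NeZero.ne Lc)))) n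
    (Sum.elim (fun _ : Fin (3 + 1) => (1 : ℝ)) (fun _ : Fin (3 + 1) => s⁻¹))
  set δ₀ : ℝ := min δ₁ δ₂ with hδ₀
  have hδ₀1 : δ₀ ≤ δ₁ := min_le_left _ _
  have hδ₀2 : δ₀ ≤ δ₂ := min_le_right _ _
  refine ⟨δ₀, C₁ + (K * Real.exp δ₂ + K), lt_min hδ₁ hδ₂, by positivity, fun μ y κ' u => ?_⟩
  set N : ℤ := (((Lc ^ (n + 1 + 1) : ℕ) : ℤ)) with hN
  have hb : ((bigRatio Lc (n + 1) : ℕ) : ℤ) = N := by rw [hN, bigRatio_eq_pow]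
  -- the column
  have hcol : |colH (chartσ Lc s n) (Lc ^ (n + 1 + 1)) μ y κ' u| ≤ C₁ * Real.exp (-δ₀ * l1 (u - N • y)) := by
    have h := abs_colH_le (N := Lc ^ (n + 1 + 1)) hA μ y κ' u
    exact h.trans (mul_le_mul_of_nonneg_left (exp_neg_mul_le_of_le hδ₀1 (l1_nonneg _)) hC₁)
  -- the two values of the gauge function
  have hlam : ∀ w : Site (3 + 1), |lamRecG Lc Q s n μ y w| ≤ K * Real.exp (-δ₂ * l1 (N • y - w)) := by
    intro w
    have h := hlamb μ y w
    rw [hb] at h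
    exact h
  have h0 : |lamRecG Lc Q s n μ y u| ≤ K * Real.exp (-δ₀ * l1 (u - N • y)) := by
    refine (hlam u).trans (mul_le_mul_of_nonneg_left ?_ hK)
    rw [l1_sub_symm]
    exact exp_neg_mul_le_of_le hδ₀2 (l1_nonneg _)
  have h1 : |lamRecG Lc Q s n μ y (u + unitVec κ')| ≤ K * Real.exp δ₂ * Real.exp (-δ₀ * l1 (u - N • y)) := by
    refine (hlam (u + unitVec κ')).trans ?_
    have htri : l1 (N • y - u) ≤ l1 (N • y - (u + unitVec κ')) + 1 := by
      have h := l1_sub_triangle (N • y) (u + unitVec κ') u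
      rwa [show u + unitVec κ' - u = unitVec κ' by abel, TowerDoorDefectFamilyLoc.l1_unitVec] at h
    have hexp : Real.exp (-δ₂ * l1 (N • y - (u + unitVec κ'))) ≤ Real.exp δ₂ * Real.exp (-δ₀ * l1 (u - N • y)) := by
      rw [← Real.exp_add]
      refine Real.exp_le_exp.2 ?_
      rw [l1_sub_symm u]
      have hr : 0 ≤ l1 (N • y - u) := l1_nonneg _
      nlinarith
    rw [mul_assoc]
    exact mul_le_mul_of_nonneg_left hexp hK
  rw [respCol_eq_sub_sub]
  calc |colH (chartσ Lc s n) (Lc ^ (n + 1 + 1)) μ y κ' u - (lamRecG Lc Q s n μ y (u + unitVec κ') - lamRecG Lc Q s n μ y u)|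
      ≤ |colH (chartσ Lc s n) (Lc ^ (n + 1 + 1)) μ y κ' u| + (|lamRecG Lc Q s n μ y (u + unitVec κ')| + |lamRecG Lc Q s n μ y u|) :=
        (abs_sub _ _).trans (add_le_add le_rfl (abs_sub _ _))
    _ ≤ C₁ * Real.exp (-δ₀ * l1 (u - N • y)) + (K * Real.exp δ₂ * Real.exp (-δ₀ * l1 (u - N • y)) + K * Real.exp (-δ₀ * l1 (u - N • y))) :=
        add_le_add hcol (add_le_add h1 h0)
    _ = (C₁ + (K * Real.exp δ₂ + K)) * Real.exp (-δ₀ * l1 (u - N • y)) := by ring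

end RespCol

/-! ## §3 The weight decays from the source at the middle scale -/

section Weight

variable (Lc : ℕ) [NeZero Lc] (Q : StepRows 3 Lc) {ℓ : Fin (3 + 1) → Site (3 + 1) → Bond (3 + 1) → ℝ} (sn : ℕ → ℝ)

/-- [folklore] **WINDOW GEOMETRY**: for a finest site `u` in the depth-`(n+1)` window of the middle site `t`, the decay weight from the coarse source block `Lc^(n+2)•y` is at most
`e^{δ·4·wid}` times the decay weight of `t` from `Lc•y` (triangle inequality through `Lc^(n+1)•t`; `|Lc^(n+1)•v|₁ = Lc^(n+1)|v|₁ ≥ |v|₁`). -/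
theorem exp_window_le {n : ℕ} {δ : ℝ} (hδ : 0 ≤ δ) {t u : Site (3 + 1)} (hu : u ∈ winF (Lc ^ (n + 1)) (wid Lc (n + 1)) t) (y : Site (3 + 1)) :
    Real.exp (-δ * l1 (u - (((Lc ^ (n + 1 + 1) : ℕ) : ℤ)) • y))
      ≤ Real.exp (δ * (((3 : ℝ) + 1) * (wid Lc (n + 1) : ℝ))) * Real.exp (-δ * l1 (t - (Lc : ℤ) • y)) := by
  rw [← Real.exp_add]
  refine Real.exp_le_exp.2 ?_
  -- |Lmid•t − u|₁ ≤ 4·wid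
  have hwin : l1 ((((Lc ^ (n + 1) : ℕ) : ℤ)) • t - u) ≤ ((3 : ℝ) + 1) * (wid Lc (n + 1) : ℝ) := l1_smul_sub_le_of_mem_winF hu
  -- |Lmid•t − Nbig•y|₁ = Lmid·|t − Lc•y|₁ ≥ |t − Lc•y|₁
  have hscale : l1 (t - (Lc : ℤ) • y) ≤ l1 ((((Lc ^ (n + 1) : ℕ) : ℤ)) • t - (((Lc ^ (n + 1 + 1) : ℕ) : ℤ)) • y) := by
    have e : (((Lc ^ (n + 1) : ℕ) : ℤ)) • t - (((Lc ^ (n + 1 + 1) : ℕ) : ℤ)) • y = (((Lc ^ (n + 1) : ℕ) : ℤ)) • (t - (Lc : ℤ) • y) := by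
      rw [smul_sub, ← mul_smul]; push_cast; ring_nf
    rw [e, l1_natCast_smul']
    have h1 : (1 : ℝ) ≤ ((Lc ^ (n + 1) : ℕ) : ℝ) := by exact_mod_cast Nat.one_le_pow _ _ (Nat.pos_of_ne_zero (NeZero.ne Lc))
    have h0 : 0 ≤ l1 (t - (Lc : ℤ) • y) := l1_nonneg _
    nlinarith
  have htri : l1 ((((Lc ^ (n + 1) : ℕ) : ℤ)) • t - (((Lc ^ (n + 1 + 1) : ℕ) : ℤ)) • y)
      ≤ l1 ((((Lc ^ (n + 1) : ℕ) : ℤ)) • t - u) + l1 (u - (((Lc ^ (n + 1 + 1) : ℕ) : ℤ)) • y) := l1_sub_triangle _ _ _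
  have h0 : 0 ≤ l1 (u - (((Lc ^ (n + 1 + 1) : ℕ) : ℤ)) • y) := l1_nonneg _
  nlinarith

/-- [folklore] **`wFRec` DECAYS FROM THE SOURCE AT THE MIDDLE SCALE**: under a uniform brick bound `|ℓ μ y f| ≤ Bℓ`,
`|wFRec Lc Q ℓ sn n μ y c t| ≤ C·e^{−δ·|t − Lc•y|₁}` — the lattice sum is a finite sum over the window `winF (Lc^(n+1)) (wid Lc (n+1)) t` (an1 `compLinKer_eq_zero`), each term is
`|compLinKer| · |respCol| ≤ ((4·(2Lc)⁴·Bℓ)^(n+1)) · C·e^{−δ|u − Lc^(n+2)•y|₁}` (an1 `abs_compLinKer_le`, §2), and the window geometry moves the decay to the middle scale. -/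
theorem exists_abs_wFRec_le {Bℓ : ℝ} (hB : 0 ≤ Bℓ) (hℓb : ∀ (μ : Fin (3 + 1)) (y : Site (3 + 1)) (f : Bond (3 + 1)), |ℓ μ y f| ≤ Bℓ) (n : ℕ) :
    ∃ δ C : ℝ, 0 < δ ∧ 0 ≤ C ∧ ∀ (μ : Fin (3 + 1)) (y : Site (3 + 1)) (c : Fin (3 + 1)) (t : Site (3 + 1)),
      |wFRec Lc Q ℓ sn n μ y c t| ≤ C * Real.exp (-δ * l1 (t - (Lc : ℤ) • y)) := by
  obtain ⟨δ, Cr, hδ, hCr, hresp⟩ := exists_abs_respCol_le Lc Q (sn n) n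
  set Cn : ℝ := ((((3 : ℝ) + 1) * (2 * (Lc : ℝ)) ^ (3 + 1) * Bℓ) ^ (n + 1)) with hCn
  set E : ℝ := Real.exp (δ * (((3 : ℝ) + 1) * (wid Lc (n + 1) : ℝ))) with hE
  set Wc : ℝ := ((wid Lc (n + 1) : ℝ) + 1) ^ (3 + 1) with hWc
  have hCn0 : 0 ≤ Cn := pow_nonneg (by positivity) _
  have hE0 : 0 ≤ E := (Real.exp_pos _).le
  have hWc0 : 0 ≤ Wc := by positivity
  refine ⟨δ, ((3 : ℝ) + 1) * (Wc * (Cn * (Cr * E))), hδ, by positivity, fun μ y c t => ?_⟩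
  set T : ℝ := Real.exp (-δ * l1 (t - (Lc : ℤ) • y)) with hT
  set U : Finset (Site (3 + 1)) := winF (Lc ^ (n + 1)) (wid Lc (n + 1)) t with hU
  have hkb : ∀ (κ' : Fin (3 + 1)) (u : Site (3 + 1)), |compLinKer (fun _ : ℕ => ℓ) Lc (n + 1) (κ', u) (c, t)| ≤ Cn :=
    fun κ' u => abs_compLinKer_le (ℓ := fun _ : ℕ => ℓ) (L := Lc) hB (fun _ μ' y' f' => hℓb μ' y' f') (n + 1) _ _
  have hslice : ∀ κ' : Fin (3 + 1),
      |∑' u : Site (3 + 1), compLinKer (fun _ : ℕ => ℓ) Lc (n + 1) (κ', u) (c, t) * respCol Lc Q (sn n) n μ y κ' u| ≤ Wc * (Cn * (Cr * E * T)) := by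
    intro κ'
    rw [tsum_eq_sum (s := U) (fun u hu => by
      rw [compLinKer_eq_zero (ℓ := fun _ : ℕ => ℓ) (n + 1) (f := (κ', u)) (g := (c, t)) (by simpa [hU] using hu), zero_mul])]
    calc |∑ u ∈ U, compLinKer (fun _ : ℕ => ℓ) Lc (n + 1) (κ', u) (c, t) * respCol Lc Q (sn n) n μ y κ' u|
        ≤ ∑ u ∈ U, Cn * (Cr * E * T) := by
          refine (Finset.abs_sum_le_sum_abs _ _).trans (Finset.sum_le_sum fun u hu => ?_)
          rw [abs_mul]
          refine mul_le_mul (hkb κ' u) ?_ (abs_nonneg _) hCn0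
          refine (hresp μ y κ' u).trans ?_
          rw [mul_assoc]
          refine mul_le_mul_of_nonneg_left ?_ hCr
          exact exp_window_le Lc hδ.le (by simpa [hU] using hu) y
      _ = (U.card : ℝ) * (Cn * (Cr * E * T)) := by rw [Finset.sum_const, nsmul_eq_mul]
      _ = Wc * (Cn * (Cr * E * T)) := by rw [hU, card_winF_real]
  rw [wFRec_eq]
  calc |∑ κ' : Fin (3 + 1), ∑' u : Site (3 + 1), compLinKer (fun _ : ℕ => ℓ) Lc (n + 1) (κ', u) (c, t) * respCol Lc Q (sn n) n μ y κ' u|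
      ≤ ∑ _κ' : Fin (3 + 1), Wc * (Cn * (Cr * E * T)) := (Finset.abs_sum_le_sum_abs _ _).trans (Finset.sum_le_sum fun κ' _ => hslice κ')
    _ = ((3 : ℝ) + 1) * (Wc * (Cn * (Cr * E))) * T := by
        rw [Finset.sum_const, Finset.card_univ, Fintype.card_fin, nsmul_eq_mul]; push_cast; ring

/-! ## §4 The road's `hwloc` at `w := wF Lc Q ℓ sn` -/

/-- [folklore] **(Lw) = THE ROAD's `hwloc` FOR THE TRUE WEIGHT**: `∀ n, ∃ δ C, 0 < δ ∧ 0 ≤ C ∧ ∀ κ l p, |wF Lc Q ℓ sn n κ l p| ≤ C·exp(−δ·|p|₁)` — §3 at the source `y = 0` and the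
middle bond `t = −p` (`|−p|₁ = |p|₁`).  Feeds `FP/TowerFTransportRowW.htr_rec_w ∕ exists_vertexFamilies_FRec_w` and `FP/TowerFAnchorRowW.hF₁_rec_w ∕ …_zero_w` BY NAME. -/
theorem hwloc_wF {Bℓ : ℝ} (hB : 0 ≤ Bℓ) (hℓb : ∀ (μ : Fin (3 + 1)) (y : Site (3 + 1)) (f : Bond (3 + 1)), |ℓ μ y f| ≤ Bℓ) :
    ∀ n : ℕ, ∃ δ C : ℝ, 0 < δ ∧ 0 ≤ C ∧ ∀ (κ l : Fin (3 + 1)) (p : Site (3 + 1)), |wF Lc Q ℓ sn n κ l p| ≤ C * Real.exp (-δ * l1 p) := by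
  intro n
  obtain ⟨δ, C, hδ, hC, h⟩ := exists_abs_wFRec_le Lc Q sn hB hℓb n
  refine ⟨δ, C, hδ, hC, fun κ l p => ?_⟩
  rw [wF_apply]
  have h' := h l 0 κ (-p)
  rwa [smul_zero, sub_zero, l1_neg'] at h'

end Weight

/-! ## §5 The two row tokens' instances, hypothesis-free -/

section Instances

variable (Lc : ℕ) [NeZero Lc] (Q : StepRows 3 Lc) (R : Roots Lc) (sn : ℕ → ℝ)

omit [NeZero Lc] in
/-- [folklore] the ROOTED brick `linKerAt (toSite (ctrOff 4 Lc)) Lc` is block covariant (PART 96's `hℓsh`; lit `linKerAt_add`). -/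
theorem hℓsh_linKerAt : ∀ (μ : Fin (3 + 1)) (y t : Site (3 + 1)) (f : Bond (3 + 1)),
    linKerAt (toSite (ctrOff (3 + 1) Lc)) Lc μ (y + t) (f.sh ((Lc : ℤ) • t)) = linKerAt (toSite (ctrOff (3 + 1) Lc)) Lc μ y f :=
  fun μ y t f => AveragingHessianKernelsRooted.linKerAt_add _ Lc μ y t f

omit [NeZero Lc] in
/-- [folklore] the SYM brick `symLinKerAt (toSite R.r) Lc` is block covariant (an1 `symLinKerAt_add`). -/
theorem hℓsh_symLinKerAt : ∀ (μ : Fin (3 + 1)) (y t : Site (3 + 1)) (f : Bond (3 + 1)),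
    symLinKerAt (toSite R.r) Lc μ (y + t) (f.sh ((Lc : ℤ) • t)) = symLinKerAt (toSite R.r) Lc μ y f :=
  fun μ y t f => SymAveragingHessianCounts.symLinKerAt_add _ Lc μ y t f

/-- [folklore] **(Lw) AT THE ROOTED ROWS, NO HYPOTHESIS LEFT**: `hwloc` for `wF Lc Q (linKerAt (toSite (ctrOff 4 Lc)) Lc) sn` (brick bound lit `abs_linKerAt_le`: `|q¹| ≤ ell 4 Lc`). -/
theorem hwloc_wF_rooted : ∀ n : ℕ, ∃ δ C : ℝ, 0 < δ ∧ 0 ≤ C ∧ ∀ (κ l : Fin (3 + 1)) (p : Site (3 + 1)),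
    |wF Lc Q (linKerAt (toSite (ctrOff (3 + 1) Lc)) Lc) sn n κ l p| ≤ C * Real.exp (-δ * l1 p) :=
  hwloc_wF Lc Q sn (Bℓ := (ell (3 + 1) Lc : ℝ)) (by positivity)
    (fun μ y f => AveragingHessianKernelsRooted.abs_linKerAt_le (one_le_of_neZero Lc) μ y (ctrOff_mem_box (one_le_of_neZero Lc)) f)

/-- [folklore] **(Lw) AT THE SYM ROWS of a root record `R`, NO HYPOTHESIS LEFT**: `hwloc` for `wF Lc Q (symLinKerAt (toSite R.r) Lc) sn` (an1 `abs_symLinKerAt_le`). -/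
theorem hwloc_wF_sym : ∀ n : ℕ, ∃ δ C : ℝ, 0 < δ ∧ 0 ≤ C ∧ ∀ (κ l : Fin (3 + 1)) (p : Site (3 + 1)),
    |wF Lc Q (symLinKerAt (toSite R.r) Lc) sn n κ l p| ≤ C * Real.exp (-δ * l1 p) :=
  hwloc_wF Lc Q sn (Bℓ := (ell (3 + 1) Lc : ℝ)) (by positivity)
    (fun μ y f => SymAveragingHessianCounts.abs_symLinKerAt_le (one_le_of_neZero Lc) μ y R.hr f)

end Instances

/-! ## §6 (Sw) — absolutely summable second moments of the true weight (gen 85 append; road `DressedEntryWardInvariance`'s `hwF` at `wF`) -/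

section Moments

variable (Lc : ℕ) [NeZero Lc] (Q : StepRows 3 Lc) {ℓ : Fin (3 + 1) → Site (3 + 1) → Bond (3 + 1) → ℝ} (R : Roots Lc) (sn : ℕ → ℝ)

open DecimatedMomentSummable (AbsMoment₂ absMoment₂_of_decay510)
open HessianTelescopingKKT (absMoment₂_const_mul')

/-- [folklore] **`AbsMoment₂ (wF … n κ l)`** under the brick bound: `hwloc_wF`'s exponential decay IS lit `B12Sec2to5.Decay510`, and lit `absMoment₂_of_decay510` turns it into an
absolutely summable second moment — the `hwF` letter of road `DressedEntryWardInvariance.hWT_of_[b]grad_…` at the true weight. -/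
theorem absMoment₂_wF {Bℓ : ℝ} (hB : 0 ≤ Bℓ) (hℓb : ∀ (μ : Fin (3 + 1)) (y : Site (3 + 1)) (f : Bond (3 + 1)), |ℓ μ y f| ≤ Bℓ)
    (n : ℕ) (κ l : Fin (3 + 1)) : AbsMoment₂ (wF Lc Q ℓ sn n κ l) := by
  obtain ⟨δ, C, hδ, _, h⟩ := hwloc_wF Lc Q sn hB hℓb n
  exact absMoment₂_of_decay510 hδ (C := C) fun p => h κ l p

/-- [folklore] the same for the RENORMALISED weight `p ↦ a · wF … n κ l p` (the END's lambda `(α n)⁻¹ • wF`, Q-an2-85-1 (a)). -/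
theorem absMoment₂_mul_wF {Bℓ : ℝ} (hB : 0 ≤ Bℓ) (hℓb : ∀ (μ : Fin (3 + 1)) (y : Site (3 + 1)) (f : Bond (3 + 1)), |ℓ μ y f| ≤ Bℓ)
    (a : ℝ) (n : ℕ) (κ l : Fin (3 + 1)) : AbsMoment₂ (fun p => a * wF Lc Q ℓ sn n κ l p) :=
  absMoment₂_const_mul' (absMoment₂_wF Lc Q sn hB hℓb n κ l) a

variable (ℓ) in
/-- [folklore] `hwloc` at the renormalised weight: `|a · wF … n κ l p| ≤ (|a|·C)·e^{−δ|p|₁}` — the END's `hwloc` for the lambda `(α n)⁻¹ • wF` (`C ↦ |(α n)⁻¹|·C`). -/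
theorem hwloc_mul_wF {Bℓ : ℝ} (hB : 0 ≤ Bℓ) (hℓb : ∀ (μ : Fin (3 + 1)) (y : Site (3 + 1)) (f : Bond (3 + 1)), |ℓ μ y f| ≤ Bℓ) (a : ℕ → ℝ) :
    ∀ n : ℕ, ∃ δ C : ℝ, 0 < δ ∧ 0 ≤ C ∧ ∀ (κ l : Fin (3 + 1)) (p : Site (3 + 1)),
      |a n * wF Lc Q ℓ sn n κ l p| ≤ C * Real.exp (-δ * l1 p) := by
  intro n
  obtain ⟨δ, C, hδ, hC, h⟩ := hwloc_wF Lc Q sn hB hℓb n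
  refine ⟨δ, |a n| * C, hδ, by positivity, fun κ l p => ?_⟩
  rw [abs_mul, mul_assoc]
  exact mul_le_mul_of_nonneg_left (h κ l p) (abs_nonneg _)

/-- [folklore] `AbsMoment₂` of the true weight at the ROOTED rows, no hypothesis left. -/
theorem absMoment₂_wF_rooted (n : ℕ) (κ l : Fin (3 + 1)) : AbsMoment₂ (wF Lc Q (linKerAt (toSite (ctrOff (3 + 1) Lc)) Lc) sn n κ l) :=
  absMoment₂_wF Lc Q sn (Bℓ := (ell (3 + 1) Lc : ℝ)) (by positivity)
    (fun μ y f => AveragingHessianKernelsRooted.abs_linKerAt_le (one_le_of_neZero Lc) μ y (ctrOff_mem_box (one_le_of_neZero Lc)) f) n κ l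

/-- [folklore] `AbsMoment₂` of the true weight at the SYM rows of a root record `R`, no hypothesis left. -/
theorem absMoment₂_wF_sym (n : ℕ) (κ l : Fin (3 + 1)) : AbsMoment₂ (wF Lc Q (symLinKerAt (toSite R.r) Lc) sn n κ l) :=
  absMoment₂_wF Lc Q sn (Bℓ := (ell (3 + 1) Lc : ℝ)) (by positivity)
    (fun μ y f => SymAveragingHessianCounts.abs_symLinKerAt_le (one_le_of_neZero Lc) μ y R.hr f) n κ l

end Moments

end Summit.QuantumFields.BalabanUV.Beta.FP.TowerFWeightRecLoc

end
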